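import Summits.NavierStokesRegularity.NavierStokesRegularity.Theorems.TypeIQuarterGateQuarterLawTypeIBackwardWindow
import HarnessLib

/-!
# `TypeIQuarterGate`: on the Type-I class the slice quarter law IS the backward-window quarter law
# (crux `QuarterLawTypeI`, stmt-NavierStokesRegularity-23726)

`--supports stmt-NavierStokesRegularity-23726` (helper; sequel to
`Theorems/TypeIQuarterGateQuarterLawTypeIBackwardWindow.lean`, p823532).

K1 = `QuarterLawTypeI` asks for the SLICE law `Z(t) := ∫‖curl u(t)‖² ≤ K/√(T−t)` along a maximal
classical Leray–Hopf solution from a rapidly decaying datum with the sup-norm Type-I rate.  The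
backward-window transfer `Z(t) ≤ (e^{C'²/2}/(T−t)) ∫_{2t−T}^{t} Z` (p823532) and one integration give,
BY NAME:

* `backwardWindowLaw_of_quarterLawTypeI`, `quarterLawTypeI_of_backwardWindowLaw`,
  `quarterLawTypeI_iff_backwardWindowLaw` — **`QuarterLawTypeI` ⟺ the BACKWARD-WINDOW QUARTER LAW**:
  along every blow-up of K1's class, `∫_{2t−T}^{t} Z(s) ds ≤ K√(T−t)` for `t` near `T`; i.e. the
  enstrophy AVERAGED over the last parabolic window `[t − (T−t), t]` obeys Leray's upper quarter rate.
  Compare the tree's `QuarterLawWindow.quarterLawTypeI_iff_energyHalfHolderTypeI` (p820364: windows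
  `[a, T)` reaching the singular time, all `a`); here only the windows `[T−2δ, T−δ]` STRICTLY BEFORE the
  singular time are charged, one per scale `δ`.

Repair-census wording for 23726: unconditionally the dissipation over backward parabolic windows is
`o(1)` as `δ = T−t → 0` (`QuarterLawBackwardWindow.exists_window_lt`, whence `Z = o((T−t)⁻¹)`);
K1 is EXACTLY the rate `O(√δ)` for these windows.  Nothing in between is claimed.

HONEST FRAMING: reformulation of an OPEN crux along a HYPOTHETICAL blow-up; `QuarterLawTypeI` remains
OPEN; nothing about Navier–Stokes regularity is claimed and no summit statement is proved. [folklore]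
-/

-- the problem directory repeats the summit name (`NavierStokesRegularity/NavierStokesRegularity`)
set_option linter.dupNamespace false

noncomputable section

open Set Filter Topology MeasureTheory Function
open scoped ENNReal NNReal

namespace Summit.NavierStokesRegularity.NavierStokesRegularity.Theorems

namespace QuarterLawBackwardWindow

open Literature.Analysis.FluidPDE
open Summit.NavierStokesRegularity.NavierStokesRegularity.Theorems.QuarterLawWindow
  (exists_rate_of_isTypeIBlowup')
open Summit.NavierStokesRegularity.NavierStokesRegularity.Theses.TypeIQuarterGate

/-! ### By name: the slice quarter law IS the backward-window quarter law on the Type-I class -/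

/-- **K1 ⟹ the backward-window law** (one integration: on the window `(2t−T, t)` every slice has
`T − s ≥ T − t`, so `Z(s) ≤ K⁺/√(T−t)`, and the window has length `T − t`). [folklore] -/
theorem backwardWindowLaw_of_quarterLawTypeI (h : QuarterLawTypeI) :
    ∀ (ν T : ℝ), 0 < ν → 0 < T →
      ∀ (u : ℝ → EuclideanSpace ℝ (Fin 3) → EuclideanSpace ℝ (Fin 3))
        (p : ℝ → EuclideanSpace ℝ (Fin 3) → ℝ),
        IsMaximalSmoothSolution ν 0 u p T → IsLerayHopfOn T ν 0 (u 0) u →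
        HasRapidSpatialDecay (u 0) → IsTypeIBlowup u T →
        ∃ K t₀ : ℝ, t₀ < T ∧ T ≤ 2 * t₀ ∧ ∀ t ∈ Ico t₀ T,
          ∫⁻ s in Ioo (2 * t - T) t, ∫⁻ x, ‖curl (u s) x‖ₑ ^ 2 ≤
            ENNReal.ofReal (K * Real.sqrt (T - t)) := by
  intro ν T hν hT u p hmax hLH hdec hI
  obtain ⟨K, hK⟩ := h ν T hν hT u p hmax hLH hdec hI
  refine ⟨max K 0, T / 2, by linarith, by linarith, fun t ht => ?_⟩
  have hδ0 : 0 < T - t := sub_pos.2 ht.2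
  have hsδ : 0 < Real.sqrt (T - t) := Real.sqrt_pos.2 hδ0
  have ht0 : 0 ≤ 2 * t - T := by linarith [ht.1]
  -- every slice of the window is bounded by `K⁺/√(T−t)`
  have hslice : ∀ s ∈ Ioo (2 * t - T) t,
      ∫⁻ x, ‖curl (u s) x‖ₑ ^ 2 ≤ ENNReal.ofReal (max K 0 / Real.sqrt (T - t)) := by
    intro s hs
    have hsT : s ∈ Ico 0 T := ⟨ht0.trans hs.1.le, hs.2.trans ht.2⟩
    refine (hK s hsT).trans (ENNReal.ofReal_le_ofReal ?_)
    calc K / Real.sqrt (T - s) ≤ max K 0 / Real.sqrt (T - s) :=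
          div_le_div_of_nonneg_right (le_max_left _ _) (Real.sqrt_nonneg _)
      _ ≤ max K 0 / Real.sqrt (T - t) :=
          div_le_div_of_nonneg_left (le_max_right _ _) hsδ
            (Real.sqrt_le_sqrt (by linarith [hs.2]))
  calc ∫⁻ s in Ioo (2 * t - T) t, ∫⁻ x, ‖curl (u s) x‖ₑ ^ 2
      ≤ ∫⁻ _ in Ioo (2 * t - T) t, ENNReal.ofReal (max K 0 / Real.sqrt (T - t)) :=
        setLIntegral_mono' measurableSet_Ioo fun s hs => hslice s hs
    _ = ENNReal.ofReal (max K 0 / Real.sqrt (T - t)) * volume (Ioo (2 * t - T) t) :=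
        setLIntegral_const _ _
    _ = ENNReal.ofReal (max K 0 * Real.sqrt (T - t)) := by
        rw [Real.volume_Ioo, show t - (2 * t - T) = T - t by ring,
          ← ENNReal.ofReal_mul (div_nonneg (le_max_right _ _) hsδ.le)]
        congr 1
        rw [div_mul_eq_mul_div, mul_div_assoc, Real.div_sqrt]

/-- **The backward-window law ⟹ K1** (the transfer `lintegral_curl_sq_le_exp_div_mul_window`:
`Z(t) ≤ (c/(T−t))·K√(T−t) = cK/√(T−t)` near `T`, then the tree's `quarterLaw_of_eventually` for the
early times). [folklore] -/
theorem quarterLawTypeI_of_backwardWindowLaw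
    (h : ∀ (ν T : ℝ), 0 < ν → 0 < T →
      ∀ (u : ℝ → EuclideanSpace ℝ (Fin 3) → EuclideanSpace ℝ (Fin 3))
        (p : ℝ → EuclideanSpace ℝ (Fin 3) → ℝ),
        IsMaximalSmoothSolution ν 0 u p T → IsLerayHopfOn T ν 0 (u 0) u →
        HasRapidSpatialDecay (u 0) → IsTypeIBlowup u T →
        ∃ K t₀ : ℝ, t₀ < T ∧ T ≤ 2 * t₀ ∧ ∀ t ∈ Ico t₀ T,
          ∫⁻ s in Ioo (2 * t - T) t, ∫⁻ x, ‖curl (u s) x‖ₑ ^ 2 ≤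
            ENNReal.ofReal (K * Real.sqrt (T - t))) :
    QuarterLawTypeI := by
  intro ν T hν hT u p hmax hLH hdec hI
  obtain ⟨C, hC⟩ := exists_rate_of_isTypeIBlowup' hν hI
  obtain ⟨t₁, ht₁, -, hwin⟩ := lintegral_curl_sq_le_exp_div_mul_window hν hT hmax.1 hLH hdec hC
  obtain ⟨K, t₀, ht₀T, -, hK⟩ := h ν T hν hT u p hmax hLH hdec hI
  set c : ℝ := Real.exp ((max C 1) ^ 2 / 2) with hc
  have hc0 : 0 < c := Real.exp_pos _
  refine LorentzOfEnvelope.quarterLaw_of_eventually hν hT hmax.1 hLH hdec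
    ⟨c * max K 0, max t₁ t₀, max_lt ht₁.2 ht₀T, fun t ht => ?_⟩
  have htt₁ : t ∈ Ico t₁ T := ⟨(le_max_left _ _).trans ht.1, ht.2⟩
  have htt₀ : t ∈ Ico t₀ T := ⟨(le_max_right _ _).trans ht.1, ht.2⟩
  have hδ0 : 0 < T - t := sub_pos.2 ht.2
  have hsδ : 0 < Real.sqrt (T - t) := Real.sqrt_pos.2 hδ0
  have hK' : ∫⁻ s in Ioo (2 * t - T) t, ∫⁻ x, ‖curl (u s) x‖ₑ ^ 2 ≤
      ENNReal.ofReal (max K 0 * Real.sqrt (T - t)) :=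
    (hK t htt₀).trans (ENNReal.ofReal_le_ofReal
      (mul_le_mul_of_nonneg_right (le_max_left _ _) hsδ.le))
  calc ∫⁻ x, ‖curl (u t) x‖ₑ ^ 2
      ≤ ENNReal.ofReal (c / (T - t)) * ∫⁻ s in Ioo (2 * t - T) t, ∫⁻ x, ‖curl (u s) x‖ₑ ^ 2 :=
        hwin t htt₁
    _ ≤ ENNReal.ofReal (c / (T - t)) * ENNReal.ofReal (max K 0 * Real.sqrt (T - t)) :=
        mul_le_mul_right hK' _
    _ = ENNReal.ofReal (c * max K 0 / Real.sqrt (T - t)) := by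
        rw [← ENNReal.ofReal_mul (div_pos hc0 hδ0).le]
        congr 1
        calc c / (T - t) * (max K 0 * Real.sqrt (T - t))
            = c * max K 0 * (Real.sqrt (T - t) / (T - t)) := by ring
          _ = c * max K 0 * (1 / Real.sqrt (T - t)) := by rw [Real.sqrt_div_self']
          _ = c * max K 0 / Real.sqrt (T - t) := by ring

/-- **BY NAME: `QuarterLawTypeI` ⟺ the BACKWARD-WINDOW QUARTER LAW on the Type-I class** — along every
blow-up of K1's class, `∫_{2t−T}^{t} ∫‖curl u(s)‖² ds ≤ K√(T−t)` for `t` near `T` (equivalently: the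
AVERAGE of the enstrophy over the last parabolic window `[t−(T−t), t]` obeys Leray's upper quarter rate).
Repair-census wording for 23726: the missing estimate is a bound of order `√δ` on the dissipation over
backward parabolic windows of length `δ = T−t`; what is proved unconditionally is `o(1)`
(`exists_window_lt`) — the gap between `o(1)` and `O(√δ)` is the crux. [folklore] -/
theorem quarterLawTypeI_iff_backwardWindowLaw :
    QuarterLawTypeI ↔
      ∀ (ν T : ℝ), 0 < ν → 0 < T →
        ∀ (u : ℝ → EuclideanSpace ℝ (Fin 3) → EuclideanSpace ℝ (Fin 3))
          (p : ℝ → EuclideanSpace ℝ (Fin 3) → ℝ),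
          IsMaximalSmoothSolution ν 0 u p T → IsLerayHopfOn T ν 0 (u 0) u →
          HasRapidSpatialDecay (u 0) → IsTypeIBlowup u T →
          ∃ K t₀ : ℝ, t₀ < T ∧ T ≤ 2 * t₀ ∧ ∀ t ∈ Ico t₀ T,
            ∫⁻ s in Ioo (2 * t - T) t, ∫⁻ x, ‖curl (u s) x‖ₑ ^ 2 ≤
              ENNReal.ofReal (K * Real.sqrt (T - t)) :=
  ⟨backwardWindowLaw_of_quarterLawTypeI, quarterLawTypeI_of_backwardWindowLaw⟩

end QuarterLawBackwardWindow

end Summit.NavierStokesRegularity.NavierStokesRegularity.Theorems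

end
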